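import Literature.Analysis.FluidPDE.ChaeAsymptoticallySelfSimilarAssembly
import Literature.Analysis.FluidPDE.LocalTypeIPersistence
import HarnessLib

/-!
# Chae 2007, Theorem 1.5: smallness at one scale from (3.16), and the assembly from local Leray
# theory (proofs companion, part 5)

Analysis/FluidPDE proofs file (theorems only: no definitions, no named facts), fifth companion of
`Literature/Analysis/FluidPDE/ChaeAsymptoticallySelfSimilar.lean` (D. Chae, Math. Ann. 338 (2007)
435–449 = arXiv:math/0604234, **Theorem 1.5**, the named fact
`chae2007_asymptoticallySelfSimilar_local`). The fourth companion reduced the fact to two inputs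
(`chae2007_asymptoticallySelfSimilar_local_of_inputs`): `h₁`, the regularity of very weak Leray
profiles, and `h₂`, which bundled (a) the suitability of the solution near `(z, T)` *up to the
blow-up time* with (b) the passage from Chae's criterion (3.16),
`lim_{r↘0} r^{(q−3)/q} sup_{T−r²<τ<T} ‖v(τ)‖_{L^q(B(z,r))} = 0`, to the smallness hypothesis of the
ε-regularity lemma ("Hence, the conclusion follows from Theorem 3.1", arXiv p. 8; Theorem 3.1 =
Gustafson–Kang–Tsai 2007, Thm 1.1). This file PROVES (b) for `q ≥ 3` and splits `h₂`
accordingly: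

* `IsSuitableWeakSolutionInBall.of_le_radius` — Albritton–Barker's class restricts to smaller
  parabolic balls with the same vertex;
* `cknC_le_of_ae_eLpNorm_le` — Hölder on the ball: `r^{(q−3)/q}‖u(t)‖_{L^q(B_r)} ≤ η` for a.e.
  `t ∈ (s − r², s)` gives `C(r) = r⁻²∫∫_{Q_r}|u|³ ≤ (η|B₁|^{(q−3)/(3q)})³` (`q ≥ 3`);
* `exists_cknC_add_cknD_lt_of_ae_eLpNorm_small` — **smallness of `C + D` at one scale**: for a
  suitable pair in `Q(z, ρ)` satisfying the scaled `L^∞_t L^q_x` bound below every level `η`,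
  `C(r₀) + D(r₀) < ε` at some `0 < r₀ ≤ ρ`, by the tree's proved pressure decay estimate
  (`seregin_sverak_pressure_decay_holds`, Seregin–Šverák 2009 (as13): `D(θr) ≤ c(θD(r) + θ⁻²C(r))`)
  iterated along `θʲ r₁` (`cknD_iterate_le_of_pressure_decay`) — in place of Gustafson–Kang–Tsai's
  argument, and for `q ≥ 3` only;
* `exists_ae_eLpNorm_le_of_tendsto_chaeLocalDeviation_zero` — (3.15) with the zero profile and
  `R = 1` ⇒ (3.16) in the a.e. form needed for an a.e.-representative `u` of `v` on `Q((T,z), ρ)`;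
* `chae2007_asymptoticallySelfSimilar_local_of_localLerayInputs` — **Theorem 1.5 from**: `h₁`
  (very weak Leray profile regularity), `h₂` = **a suitable representative up to the final time**
  (some `(u, P)` of Albritton–Barker's class in a parabolic ball `Q((T, z), ρ)`, `ρ² ≤ T`, with
  `u = v` a.e. there — the output of local Leray theory: a local Leray solution on `(0, T') × ℝ³`,
  `T' > T`, from `v(0) ∈ L^p ⊂ E²`, identified with `v` on `(0, T)`; cf. the tree's facts
  `localEnergySolution_exists_local_of_memE2`, `localEnergySolution_extension_of_memE2`,
  `local_leray_weak_strong_uniqueness`), and `h₃` = the `2 ≤ q < 3` ε-regularity input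
  (Gustafson–Kang–Tsai's Thm 1.1 for `L^∞_t L^q_x`, `3/2 < q < 3`, whose energy-class
  interpolation is not in the tree).

## References

* D. Chae, Math. Ann. 338 (2007) = arXiv:math/0604234, proof of Thm 1.5, (3.15)–(3.16), Thm 3.1
  (arXiv pp. 7–8) [Chae2007].
* S. Gustafson, K. Kang, T.-P. Tsai, Comm. Math. Phys. 273 (2007) 161–176, Thm 1.1
  [GustafsonKangTsai2007].
* G. Seregin, V. Šverák, Comm. PDE 34 (2009) = arXiv:0804.1803, proof of Lemma 3.5, (as13)
  [SereginSverak2009].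
* D. Albritton, T. Barker, J. Math. Fluid Mech. 21 (2019), Def. 2.1 [AlbrittonBarker2019].
-/

noncomputable section

open _root_.MeasureTheory Set Function Filter Metric TopologicalSpace
open scoped NNReal ENNReal _root_.Topology RealInnerProductSpace Laplacian

namespace Literature.Analysis.FluidPDE

section InBallRadius

variable {u : ℝ → EuclideanSpace ℝ (Fin 3) → EuclideanSpace ℝ (Fin 3)}
  {p : ℝ → EuclideanSpace ℝ (Fin 3) → ℝ}

/-- **Restriction of Albritton–Barker's class to a smaller parabolic ball with the same vertex**
(every clause restricts: the local notion to the open sub-cylinder, the energy class to the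
shorter time window and the smaller ball, the gradient and pressure classes by monotonicity of
the integrals). [folklore] -/
theorem IsSuitableWeakSolutionInBall.of_le_radius {R R' : ℝ} {z : ℝ × EuclideanSpace ℝ (Fin 3)}
    (h : IsSuitableWeakSolutionInBall R' z u p) (hR : 0 < R) (hRR' : R ≤ R') :
    IsSuitableWeakSolutionInBall R z u p := by
  obtain ⟨hsw, ⟨C, hC⟩, ⟨G, hG, hG2⟩, hp⟩ := h
  have hsub : parabolicCylinder R z ⊆ parabolicCylinder R' z := parabolicCylinder_mono hR.le hRR' z
  have hle : parabolicCylinderOpens R z ≤ parabolicCylinderOpens R' z := hsub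
  refine ⟨hsw.of_le hle, ⟨C, ?_⟩, ⟨G, hG.mono hle, lt_of_le_of_lt (lintegral_mono_set hsub) hG2⟩,
    hp.mono_measure (Measure.restrict_mono hsub le_rfl)⟩
  have hI : Ioo (z.1 - R ^ 2) z.1 ⊆ Ioo (z.1 - R' ^ 2) z.1 := by
    refine Ioo_subset_Ioo ?_ le_rfl
    nlinarith
  have hC' := ae_restrict_of_ae_restrict_of_subset hI hC
  filter_upwards [hC'] with t ht
  exact (lintegral_mono_set (ball_subset_ball hRR')).trans ht

end InBallRadius

section Smallness

variable {u : ℝ → EuclideanSpace ℝ (Fin 3) → EuclideanSpace ℝ (Fin 3)}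
  {p : ℝ → EuclideanSpace ℝ (Fin 3) → ℝ}

/-- **The cubic functional under the scaled `L^∞_t L^q_x` bound** (the passage from Chae's (3.16)
to `C(r)`, `q ≥ 3`, by Hölder's inequality on the ball): if for a.e. `t ∈ (s - r², s)` the slice
`u(t)` is measurable on `B(a, r)` with `r^{(q−3)/q} ‖u(t)‖_{L^q(B(a,r))} ≤ η`, then
`∫_{B(a,r)} |u(t)|³ ≤ (η |B₁|^{(q−3)/(3q)})³` for a.e. such `t`
(`‖u(t)‖_{L³(B_r)} ≤ |B_r|^{1/3−1/q} ‖u(t)‖_{L^q(B_r)}`, `|B_r| = r³|B₁|`), hence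
`C(r) = r⁻² ∫∫_{Q_r} |u|³ ≤ (η |B₁|^{(q−3)/(3q)})³`. [cite: Chae2007, proof of Thm 1.5, (3.16) (arXiv p. 8)] -/
theorem cknC_le_of_ae_eLpNorm_le {q : ℝ≥0} (hq : 3 ≤ q) {z : ℝ × EuclideanSpace ℝ (Fin 3)}
    {r η : ℝ} (hr : 0 < r)
    (hmeas : AEStronglyMeasurable (uncurry u) (volume.restrict (parabolicCylinder r z)))
    (hS : ∀ᵐ t ∂(volume.restrict (Ioo (z.1 - r ^ 2) z.1)),
      eLpNorm (u t) (q : ℝ≥0∞) (volume.restrict (ball z.2 r)) *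
        ENNReal.ofReal (r ^ (((q : ℝ) - 3) / q)) ≤ ENNReal.ofReal η) :
    cknC r z u ≤ (ENNReal.ofReal η *
      volume (ball (0 : EuclideanSpace ℝ (Fin 3)) 1) ^ (((q : ℝ) - 3) / (3 * q))) ^ 3 := by
  set V₁ : ℝ≥0∞ := volume (ball (0 : EuclideanSpace ℝ (Fin 3)) 1) with hV₁
  set a : ℝ := ((q : ℝ) - 3) / (3 * q) with ha
  set K : ℝ≥0∞ := ENNReal.ofReal η * V₁ ^ a with hK
  have hq3 : (3 : ℝ) ≤ q := by exact_mod_cast hq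
  have hqpos : (0 : ℝ) < q := by linarith
  have ha0 : 0 ≤ a := by rw [ha]; exact div_nonneg (by linarith) (by positivity)
  -- measure of the ball
  have hvol : volume (ball z.2 r) = ENNReal.ofReal (r ^ 3) * V₁ := by
    rw [hV₁, Measure.addHaar_ball_of_pos volume z.2 hr, finrank_euclideanSpace_fin]
  -- slice measurability
  have hprod : (volume.restrict (parabolicCylinder r z) : Measure (ℝ × EuclideanSpace ℝ (Fin 3))) =
      ((volume : Measure ℝ).restrict (Ioo (z.1 - r ^ 2) z.1)).prod
        ((volume : Measure (EuclideanSpace ℝ (Fin 3))).restrict (ball z.2 r)) := by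
    rw [parabolicCylinder, Measure.volume_eq_prod, Measure.prod_restrict]
  have hslice : ∀ᵐ t ∂(volume.restrict (Ioo (z.1 - r ^ 2) z.1)),
      AEStronglyMeasurable (u t) (volume.restrict (ball z.2 r)) := by
    have h := hmeas
    rw [hprod] at h
    exact h.prodMk_left
  -- the slice bound
  have hball : ∀ᵐ t ∂(volume.restrict (Ioo (z.1 - r ^ 2) z.1)),
      ∫⁻ x in ball z.2 r, ‖u t x‖ₑ ^ (3 : ℕ) ≤ K ^ 3 := by
    filter_upwards [hS, hslice] with t ht hmt
    have hq3' : (3 : ℝ≥0∞) ≤ (q : ℝ≥0∞) := by exact_mod_cast hq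
    -- Hölder on the ball: `‖u‖₃ ≤ ‖u‖_q |B_r|^{1/3 - 1/q}`
    have h1 := eLpNorm_le_eLpNorm_mul_rpow_measure_univ hq3' hmt
    rw [Measure.restrict_apply_univ, hvol] at h1
    have hexp : 1 / (3 : ℝ≥0∞).toReal - 1 / ((q : ℝ≥0∞)).toReal = a := by
      simp only [ENNReal.toReal_ofNat, ENNReal.coe_toReal, ha]
      field_simp
    rw [hexp] at h1
    have hsplit : (ENNReal.ofReal (r ^ 3) * V₁) ^ a =
        ENNReal.ofReal (r ^ (((q : ℝ) - 3) / q)) * V₁ ^ a := by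
      rw [ENNReal.mul_rpow_of_nonneg _ _ ha0, ENNReal.ofReal_rpow_of_nonneg (by positivity) ha0,
        ← Real.rpow_natCast, ← Real.rpow_mul hr.le]
      congr 2
      rw [ha]
      push_cast
      field_simp
    rw [hsplit] at h1
    have h2 : eLpNorm (u t) 3 (volume.restrict (ball z.2 r)) ≤ K := by
      calc eLpNorm (u t) 3 (volume.restrict (ball z.2 r))
          ≤ eLpNorm (u t) (q : ℝ≥0∞) (volume.restrict (ball z.2 r)) *
              (ENNReal.ofReal (r ^ (((q : ℝ) - 3) / q)) * V₁ ^ a) := h1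
        _ = (eLpNorm (u t) (q : ℝ≥0∞) (volume.restrict (ball z.2 r)) *
              ENNReal.ofReal (r ^ (((q : ℝ) - 3) / q))) * V₁ ^ a := by ring
        _ ≤ ENNReal.ofReal η * V₁ ^ a := mul_le_mul' ht le_rfl
    -- `∫ |u|³ = ‖u‖₃³`
    have h3 : ∫⁻ x in ball z.2 r, ‖u t x‖ₑ ^ (3 : ℕ) =
        eLpNorm (u t) 3 (volume.restrict (ball z.2 r)) ^ 3 := by
      rw [eLpNorm_eq_lintegral_rpow_enorm_toReal (by norm_num) (by norm_num)]
      simp only [ENNReal.toReal_ofNat, one_div]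
      rw [← ENNReal.rpow_natCast, ← ENNReal.rpow_mul]
      norm_num
    rw [h3]
    exact pow_le_pow_left' h2 3
  -- integrate in time
  have hmeas3 : AEMeasurable (fun w : ℝ × EuclideanSpace ℝ (Fin 3) => ‖u w.1 w.2‖ₑ ^ (3 : ℕ))
      (((volume : Measure ℝ).restrict (Ioo (z.1 - r ^ 2) z.1)).prod
        ((volume : Measure (EuclideanSpace ℝ (Fin 3))).restrict (ball z.2 r))) := by
    have h := hmeas
    rw [hprod] at h
    exact h.aemeasurable.enorm.pow_const 3
  have hQ : ∫⁻ w in parabolicCylinder r z, ‖u w.1 w.2‖ₑ ^ (3 : ℕ) ≤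
      ENNReal.ofReal (r ^ 2) * K ^ 3 := by
    rw [hprod, lintegral_prod _ hmeas3]
    calc ∫⁻ t in Ioo (z.1 - r ^ 2) z.1, ∫⁻ x in ball z.2 r, ‖u t x‖ₑ ^ (3 : ℕ)
        ≤ ∫⁻ _ in Ioo (z.1 - r ^ 2) z.1, K ^ 3 := lintegral_mono_ae hball
      _ = ENNReal.ofReal (r ^ 2) * K ^ 3 := by
          rw [lintegral_const, Measure.restrict_apply_univ, Real.volume_Ioo, mul_comm]
          congr 1
          congr 1
          ring
  rw [cknC]
  calc (ENNReal.ofReal r ^ 2)⁻¹ * ∫⁻ w in parabolicCylinder r z, ‖u w.1 w.2‖ₑ ^ (3 : ℕ)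
      ≤ (ENNReal.ofReal r ^ 2)⁻¹ * (ENNReal.ofReal (r ^ 2) * K ^ 3) := mul_le_mul' le_rfl hQ
    _ = K ^ 3 := by
        rw [← mul_assoc, ENNReal.ofReal_pow hr.le, ENNReal.inv_mul_cancel
          (pow_ne_zero 2 (ENNReal.ofReal_pos.2 hr).ne') (ENNReal.pow_ne_top ENNReal.ofReal_ne_top),
          one_mul]

/-- **Smallness of `C + D` at one scale from the scaled `L^∞_t L^q_x` criterion, `q ≥ 3`** (the
passage from Chae's (3.16) to the hypothesis of the ε-regularity lemma; Chae 2007, proof of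
Thm 1.5, last paragraph, with Gustafson–Kang–Tsai 2007 Thm 1.1 in the background; here by the
tree's proved pressure decay estimate of Seregin–Šverák 2009, (as13), iterated). Let `(u, p)` be a
suitable weak solution in the parabolic ball `Q(z, ρ)` (Albritton–Barker's class
`IsSuitableWeakSolutionInBall`) and `q ≥ 3`, and suppose that for every `η > 0` there is a radius
`r₁ ≤ ρ` below which `r^{(q−3)/q} ‖u(t)‖_{L^q(B(z,r))} ≤ η` for a.e. `t ∈ (s − r², s)` (`z = (s, a)`).
Then for every `ε > 0` there is `0 < r₀ ≤ ρ` with `C(r₀) + D(r₀) < ε`: `C(r) ≤ cη³` for `r ≤ r₁`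
(`cknC_le_of_ae_eLpNorm_le`), `D(r₁) < ∞` from the pressure class, and the decay estimate
`D(θr) ≤ c(θD(r) + θ⁻²C(r))` (`seregin_sverak_pressure_decay_holds`) iterated along `θʲr₁`
(`cknD_iterate_le_of_pressure_decay`) makes `D(θᴶr₁) ≤ 2^{-J}D(r₁) + 2cθ⁻²·cη³` small.
[cite: Chae2007, proof of Thm 1.5, (3.16) ⇒ Thm 3.1 (arXiv p. 8); SereginSverak2009 proof of Lemma 3.5 (as13)] -/
theorem exists_cknC_add_cknD_lt_of_ae_eLpNorm_small {ρ : ℝ}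
    {z : ℝ × EuclideanSpace ℝ (Fin 3)} (hIB : IsSuitableWeakSolutionInBall ρ z u p)
    {q : ℝ≥0} (hq : 3 ≤ q)
    (hS : ∀ η : ℝ, 0 < η → ∃ r₁ : ℝ, 0 < r₁ ∧ r₁ ≤ ρ ∧ ∀ r : ℝ, 0 < r → r ≤ r₁ →
      ∀ᵐ t ∂(volume.restrict (Ioo (z.1 - r ^ 2) z.1)),
        eLpNorm (u t) (q : ℝ≥0∞) (volume.restrict (ball z.2 r)) *
          ENNReal.ofReal (r ^ (((q : ℝ) - 3) / q)) ≤ ENNReal.ofReal η)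
    {ε : ℝ} (hε : 0 < ε) :
    ∃ r₀ : ℝ, 0 < r₀ ∧ r₀ ≤ ρ ∧ cknC r₀ z u + cknD r₀ z p < ENNReal.ofReal ε := by
  obtain ⟨hsuit, -, -, hp⟩ := hIB
  have hdist : IsDistributionalNSSolutionOn (parabolicCylinderOpens ρ z) 1 0 u p :=
    hsuit.distributional
  have hmeasρ : AEStronglyMeasurable (uncurry u) (volume.restrict (parabolicCylinder ρ z)) :=
    hdist.1.aestronglyMeasurable
  -- constants of the decay estimate
  obtain ⟨c, hPD⟩ := seregin_sverak_pressure_decay_holds.ratio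
  obtain ⟨θ, hθ, hθhalf, hcθ⟩ := exists_ratio_mul_le_half c
  have hθ1 : θ ≤ 1 := hθhalf.trans (by norm_num)
  set V₁ : ℝ≥0∞ := volume (ball (0 : EuclideanSpace ℝ (Fin 3)) 1) with hV₁
  have hV₁top : V₁ ≠ ∞ := measure_ball_lt_top.ne
  set a : ℝ := ((q : ℝ) - 3) / (3 * q) with ha
  have hq3 : (3 : ℝ) ≤ q := by exact_mod_cast hq
  have ha0 : 0 ≤ a := by rw [ha]; exact div_nonneg (by linarith) (by positivity)
  set Va : ℝ≥0∞ := V₁ ^ a with hVa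
  have hVatop : Va ≠ ∞ := ENNReal.rpow_ne_top_of_nonneg ha0 hV₁top
  set Θ : ℝ≥0∞ := ENNReal.ofReal ((θ⁻¹) ^ 2) with hΘ
  set L : ℝ≥0∞ := 1 + 2 * ((c : ℝ≥0∞) * Θ) with hL
  have hLtop : L ≠ ∞ := ENNReal.add_ne_top.2 ⟨ENNReal.one_ne_top,
    ENNReal.mul_ne_top ENNReal.ofNat_ne_top
      (ENNReal.mul_ne_top ENNReal.coe_ne_top ENNReal.ofReal_ne_top)⟩
  set εE : ℝ≥0∞ := ENNReal.ofReal (ε / 2) with hεE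
  have hε4 : 0 < εE / 4 :=
    ENNReal.div_pos (ENNReal.ofReal_pos.2 (by positivity)).ne' ENNReal.ofNat_ne_top
  -- (A) the level `η` and the radius `r₁`
  obtain ⟨ηA, hηA, hA⟩ := exists_forall_ofReal_pow_three_mul_le (N := L * Va ^ 3)
    (ENNReal.mul_ne_top hLtop (ENNReal.pow_ne_top hVatop)) hε4
  obtain ⟨r₁, hr₁, hr₁ρ, hSr⟩ := hS ηA hηA
  set e : ℝ≥0∞ := ENNReal.ofReal (ηA ^ 3) * Va ^ 3 with he
  have hLe : L * e ≤ εE / 4 := by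
    have := hA ηA hηA le_rfl
    calc L * e = ENNReal.ofReal (ηA ^ 3) * (L * Va ^ 3) := by rw [he]; ring
      _ ≤ εE / 4 := this
  have hCe : ∀ r : ℝ, 0 < r → r ≤ r₁ → cknC r z u ≤ e := by
    intro r hr hrr₁
    have hsub : parabolicCylinder r z ⊆ parabolicCylinder ρ z :=
      parabolicCylinder_mono hr.le (hrr₁.trans hr₁ρ) z
    have hmeas : AEStronglyMeasurable (uncurry u) (volume.restrict (parabolicCylinder r z)) :=
      hmeasρ.mono_measure (Measure.restrict_mono hsub le_rfl)
    refine (cknC_le_of_ae_eLpNorm_le hq hr hmeas (hSr r hr hrr₁)).trans (le_of_eq ?_)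
    rw [he, mul_pow, ENNReal.ofReal_pow hηA.le]
  -- (B) the number of steps
  set P : ℝ≥0∞ := (ENNReal.ofReal r₁ ^ 2)⁻¹ *
    ∫⁻ w in parabolicCylinder ρ z, ‖p w.1 w.2‖ₑ ^ (3 / 2 : ℝ) with hPdef
  have hp32 : ∫⁻ w in parabolicCylinder ρ z, ‖p w.1 w.2‖ₑ ^ (3 / 2 : ℝ) < ∞ := by
    have h := lintegral_rpow_enorm_lt_top_of_eLpNorm_lt_top (by norm_num)
      (by simp [ENNReal.div_eq_top]) hp.2
    have e32 : ((3 / 2 : ℝ≥0∞)).toReal = (3 / 2 : ℝ) := by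
      rw [ENNReal.toReal_div]; norm_num
    simpa only [e32, uncurry] using h
  have hPtop : P ≠ ∞ :=
    ENNReal.mul_ne_top (ENNReal.inv_ne_top.2 (pow_ne_zero 2 (ENNReal.ofReal_pos.2 hr₁).ne')) hp32.ne
  obtain ⟨J, hJ⟩ := exists_inv_two_pow_mul_le hPtop hε4
  -- the final scale `s = θᴶ r₁`
  set s : ℝ := θ ^ J * r₁ with hsdef
  have hs : 0 < s := by positivity
  have hsr₁ : s ≤ r₁ := mul_le_of_le_one_left hr₁.le (pow_le_one₀ hθ.le hθ1)
  have hscale0 : ∀ j : ℕ, 0 < θ ^ j * r₁ := fun j => by positivity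
  have hscale1 : ∀ j : ℕ, θ ^ j * r₁ ≤ r₁ := fun j =>
    mul_le_of_le_one_left hr₁.le (pow_le_one₀ hθ.le hθ1)
  have hsubQ : parabolicCylinder r₁ z ⊆ (parabolicCylinderOpens ρ z : Set (ℝ × EuclideanSpace ℝ (Fin 3))) :=
    parabolicCylinder_mono hr₁.le hr₁ρ z
  have hD : cknD s z p ≤ (2⁻¹ : ℝ≥0∞) ^ J * cknD r₁ z p + 2 * ((c : ℝ≥0∞) * Θ * e) :=
    cknD_iterate_le_of_pressure_decay hPD hθ hθ1 hcθ hdist hr₁ hsubQ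
      (fun j _ => hCe _ (hscale0 j) (hscale1 j))
  have hD0 : cknD r₁ z p ≤ P := cknD_le_of_subset p hsubQ
  have hsmall : cknC s z u + cknD s z p ≤ εE := by
    have h1 : cknC s z u ≤ e := hCe s hs hsr₁
    have h3 : (2⁻¹ : ℝ≥0∞) ^ J * cknD r₁ z p ≤ εE / 4 := le_trans (by gcongr) hJ
    calc cknC s z u + cknD s z p
        ≤ e + ((2⁻¹ : ℝ≥0∞) ^ J * cknD r₁ z p + 2 * ((c : ℝ≥0∞) * Θ * e)) := add_le_add h1 hD
      _ = L * e + (2⁻¹ : ℝ≥0∞) ^ J * cknD r₁ z p := by rw [hL]; ring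
      _ ≤ εE / 4 + εE / 4 := add_le_add hLe h3
      _ ≤ εE / 4 + εE / 4 + εE / 4 := le_self_add
      _ ≤ εE := ENNReal.add_quarters_le εE
  refine ⟨s, hs, hsr₁.trans hr₁ρ, hsmall.trans_lt ?_⟩
  rw [hεE]
  exact (ENNReal.ofReal_lt_ofReal_iff hε).2 (by linarith)

end Smallness

/-! ### From the vanishing deviation to the a.e. scaled `L^q` bound, and the assembly -/

section LocalLerayAssembly

/-- **(3.15) with the zero profile ⇒ (3.16), a.e. form, for an a.e.-representative** (Chae 2007,
proof of Thm 1.5: "We set `R = 1` and `√(T−t) = r` in (3.15), which becomes (3.16)"): if Chae's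
deviation of `v` from the zero profile with `R = 1` tends to `0` as `t ↑ T`, and `u = v` a.e. on
`Q((T, z), ρ)`, then for every `η > 0` there is `r₁ ≤ ρ` such that for `0 < r ≤ r₁` and a.e.
`τ ∈ (T − r², T)`, `r^{(q−3)/q} ‖u(τ)‖_{L^q(B(z, r))} ≤ η` (the deviation at `t = T − r²` is
`r^{(q−3)/q} sup_{T−r²<τ<T} ‖v(τ)‖_{L^q(B(z,r))}`; the slices of `u` and `v` agree a.e. for a.e.
`τ`). [cite: Chae2007, proof of Thm 1.5, (3.15)–(3.16) (arXiv p. 8)] -/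
theorem exists_ae_eLpNorm_le_of_tendsto_chaeLocalDeviation_zero {T : ℝ} {z : EuclideanSpace ℝ (Fin 3)}
    {q : ℝ≥0} {v u : ℝ → EuclideanSpace ℝ (Fin 3) → EuclideanSpace ℝ (Fin 3)} {ρ : ℝ} (hρ : 0 < ρ)
    (h : Tendsto (chaeLocalDeviation T z q 1 v 0) (𝓝[<] T) (𝓝 0))
    (huv : uncurry u =ᵐ[volume.restrict (parabolicCylinder ρ (T, z))] uncurry v)
    {η : ℝ} (hη : 0 < η) :
    ∃ r₁ : ℝ, 0 < r₁ ∧ r₁ ≤ ρ ∧ ∀ r : ℝ, 0 < r → r ≤ r₁ →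
      ∀ᵐ t ∂(volume.restrict (Ioo ((T, z).1 - r ^ 2) (T, z).1)),
        eLpNorm (u t) (q : ℝ≥0∞) (volume.restrict (ball (T, z).2 r)) *
          ENNReal.ofReal (r ^ (((q : ℝ) - 3) / q)) ≤ ENNReal.ofReal η := by
  -- `dev(t) ≤ η` for `t ∈ (T - δ, T)`
  have hev : ∀ᶠ t in 𝓝[<] T, chaeLocalDeviation T z q 1 v 0 t ≤ ENNReal.ofReal η :=
    h.eventually (Iic_mem_nhds (ENNReal.ofReal_pos.2 hη))
  obtain ⟨δ', hδ', hsub⟩ := mem_nhdsLT_iff_exists_Ioo_subset.1 hev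
  set δ : ℝ := T - δ' with hδ
  have hδ0 : 0 < δ := by rw [hδ]; linarith [mem_Iio.1 hδ']
  -- the radius `r₁`
  set r₁ : ℝ := min ρ (Real.sqrt δ / 2) with hr₁
  have hr₁0 : 0 < r₁ := lt_min hρ (by positivity)
  refine ⟨r₁, hr₁0, min_le_left _ _, fun r hr hrr₁ => ?_⟩
  have hr2 : r ^ 2 < δ := by
    have h1 : r ≤ Real.sqrt δ / 2 := hrr₁.trans (min_le_right _ _)
    have h2 : Real.sqrt δ ^ 2 = δ := Real.sq_sqrt hδ0.le
    nlinarith [Real.sqrt_nonneg δ]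
  have ht : T - r ^ 2 ∈ Ioo δ' T := ⟨by rw [hδ] at hr2; linarith, by nlinarith⟩
  have hdev := hsub ht
  rw [mem_setOf_eq, chaeLocalDeviation_def] at hdev
  have hTt : T - (T - r ^ 2) = r ^ 2 := by ring
  rw [hTt, Real.sqrt_sq hr.le, one_mul] at hdev
  have hpow : (r ^ 2) ^ (((q : ℝ) - 3) / (2 * (q : ℝ))) = r ^ (((q : ℝ) - 3) / q) := by
    rw [← Real.rpow_natCast, ← Real.rpow_mul hr.le]
    congr 1
    push_cast
    rcases eq_or_ne (q : ℝ) 0 with hq0 | hq0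
    · simp [hq0]
    · field_simp
  rw [hpow] at hdev
  -- the slices of `u` and `v` agree a.e., for a.e. `τ`
  have hsubQ : parabolicCylinder r (T, z) ⊆ parabolicCylinder ρ (T, z) :=
    parabolicCylinder_mono hr.le (hrr₁.trans (min_le_left _ _)) (T, z)
  have huv' : ∀ᵐ w ∂(volume.restrict (parabolicCylinder r (T, z))), uncurry u w = uncurry v w :=
    ae_restrict_of_ae_restrict_of_subset hsubQ huv
  have hprod : (volume.restrict (parabolicCylinder r (T, z)) : Measure (ℝ × EuclideanSpace ℝ (Fin 3))) =
      ((volume : Measure ℝ).restrict (Ioo (T - r ^ 2) T)).prod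
        ((volume : Measure (EuclideanSpace ℝ (Fin 3))).restrict (ball z r)) := by
    rw [parabolicCylinder, Measure.volume_eq_prod, Measure.prod_restrict]
  rw [hprod] at huv'
  have hslice : ∀ᵐ τ ∂(volume.restrict (Ioo (T - r ^ 2) T)),
      u τ =ᵐ[volume.restrict (ball z r)] v τ := Measure.ae_ae_of_ae_prod huv'
  filter_upwards [hslice, ae_restrict_mem measurableSet_Ioo] with τ hτ hτI
  rw [eLpNorm_congr_ae hτ, mul_comm]
  refine le_trans (mul_le_mul' le_rfl ?_) hdev
  have := le_iSup₂ (f := fun τ (_ : τ ∈ Ioo (T - r ^ 2) T) => eLpNorm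
    (fun x => v τ x - (Real.sqrt (T - τ))⁻¹ • (0 : EuclideanSpace ℝ (Fin 3) → EuclideanSpace ℝ (Fin 3))
      ((Real.sqrt (T - τ))⁻¹ • (x - z))) (q : ℝ≥0∞) (volume.restrict (ball z r))) τ hτI
  simpa using this

/-- **Chae 2007, Theorem 1.5, assembled from local Leray theory up to the blow-up time.** Same as
`chae2007_asymptoticallySelfSimilar_local_of_inputs`, with the suitability-and-smallness input
`h₂` split into what local Leray theory delivers and what the tree now proves:

* `h₁` — regularity of very weak Leray profiles (as before);
* `h₂` — **a suitable representative up to the final time**: for the Kato-class classical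
  solution `v` on `ℝ³ × (0, T)` and every `z`, some pair `(u, P)` is a suitable weak solution in
  a parabolic ball `Q((T, z), ρ)`, `ρ² ≤ T`, hanging from the final time (Albritton–Barker's
  class) with `u = v` a.e. there — the output of local Leray theory (a local Leray solution on
  `(0, T') × ℝ³`, `T' > T`, issued from `v(0) ∈ L^p ⊂ E²` and identified with `v` on `(0, T)` by
  weak–strong uniqueness; cf. the tree's facts `localEnergySolution_exists_local_of_memE2`,
  `localEnergySolution_extension_of_memE2`, `local_leray_weak_strong_uniqueness`, and
  `IsSuitableWeakSolutionOn.isSuitableWeakSolutionInBall`);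
* `h₃` — **the ε-regularity input for `2 ≤ q < 3`** (Gustafson–Kang–Tsai 2007, Thm 1.1 with
  `L^∞_t L^q_x`, `3/2 < q < 3`: smallness of `C + D` at one scale from the scaled `L^∞_t L^q_x`
  bound, which for `q < 3` needs the energy-class interpolation of their §3 — not in the tree).

For `q ≥ 3` the passage from (3.16) to the smallness of `C + D` is the tree's
`exists_cknC_add_cknD_lt_of_ae_eLpNorm_small` (pressure decay estimate, iterated), and (3.15) ⇒
(3.16) in a.e. form for the representative is
`exists_ae_eLpNorm_le_of_tendsto_chaeLocalDeviation_zero`.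
[cite: Chae2007, Thm 1.5 and its proof (arXiv pp. 7–8)] -/
theorem chae2007_asymptoticallySelfSimilar_local_of_localLerayInputs
    (h₁ : ∀ (V : EuclideanSpace ℝ (Fin 3) → EuclideanSpace ℝ (Fin 3)) (p : ℝ≥0), 3 ≤ p →
      MemLp V (p : ℝ≥0∞) volume → IsWeaklyDivFree V →
      (∀ Φ : EuclideanSpace ℝ (Fin 3) → EuclideanSpace ℝ (Fin 3),
        FunctionSpaces.IsTestFunctionOn (⊤ : Opens (EuclideanSpace ℝ (Fin 3))) Φ →
        VectorCalculus.IsDivFree Φ →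
        ∫ w, (⟪V w, (Δ Φ) w⟫ + ⟪V w, Φ w⟫ + 1 / 2 * ⟪V w, fderiv ℝ Φ w w⟫ +
          ⟪V w, fderiv ℝ Φ w (V w)⟫) = 0) →
      ∃ (U : EuclideanSpace ℝ (Fin 3) → EuclideanSpace ℝ (Fin 3)) (P : EuclideanSpace ℝ (Fin 3) → ℝ),
        IsLerayProfile 1 (1 / 2) U P ∧ V =ᵐ[volume] U)
    (h₂ : ∀ ⦃T : ℝ⦄, 0 < T → ∀ ⦃p : ℝ≥0⦄, 3 ≤ p →
      ∀ ⦃v : ℝ → EuclideanSpace ℝ (Fin 3) → EuclideanSpace ℝ (Fin 3)⦄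
        ⦃π : ℝ → EuclideanSpace ℝ (Fin 3) → ℝ⦄,
      IsClassicalNSSolutionOn (Ioo 0 T) 1 0 v π → ContinuousInLpOn (Ico 0 T) p v →
      ∀ z : EuclideanSpace ℝ (Fin 3), ∃ ρ : ℝ, 0 < ρ ∧ ρ ^ 2 ≤ T ∧
        ∃ (u : ℝ → EuclideanSpace ℝ (Fin 3) → EuclideanSpace ℝ (Fin 3))
          (P : ℝ → EuclideanSpace ℝ (Fin 3) → ℝ),
          IsSuitableWeakSolutionInBall ρ (T, z) u P ∧
          uncurry u =ᵐ[volume.restrict (parabolicCylinder ρ (T, z))] uncurry v)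
    (h₃ : ∀ ⦃ρ : ℝ⦄ ⦃z : ℝ × EuclideanSpace ℝ (Fin 3)⦄
      ⦃u : ℝ → EuclideanSpace ℝ (Fin 3) → EuclideanSpace ℝ (Fin 3)⦄
      ⦃P : ℝ → EuclideanSpace ℝ (Fin 3) → ℝ⦄ ⦃q : ℝ≥0⦄,
      IsSuitableWeakSolutionInBall ρ z u P → 2 ≤ q → q < 3 →
      (∀ η : ℝ, 0 < η → ∃ r₁ : ℝ, 0 < r₁ ∧ r₁ ≤ ρ ∧ ∀ r : ℝ, 0 < r → r ≤ r₁ →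
        ∀ᵐ t ∂(volume.restrict (Ioo (z.1 - r ^ 2) z.1)),
          eLpNorm (u t) (q : ℝ≥0∞) (volume.restrict (ball z.2 r)) *
            ENNReal.ofReal (r ^ (((q : ℝ) - 3) / q)) ≤ ENNReal.ofReal η) →
      ∀ ε : ℝ, 0 < ε → ∃ r₀ : ℝ, 0 < r₀ ∧ r₀ ≤ ρ ∧ cknC r₀ z u + cknD r₀ z P < ENNReal.ofReal ε) :
    chae2007_asymptoticallySelfSimilar_local := by
  refine chae2007_asymptoticallySelfSimilar_local_of_inputs h₁ ?_
  intro T hT p hp v π hv hvc z q hq2 hall0 ε hε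
  obtain ⟨ρ, hρ, hρT, u, P, hIB, huv⟩ := h₂ hT hp hv hvc z
  -- the a.e. scaled `L^q` bound for the representative `u`
  have hS : ∀ η : ℝ, 0 < η → ∃ r₁ : ℝ, 0 < r₁ ∧ r₁ ≤ ρ ∧ ∀ r : ℝ, 0 < r → r ≤ r₁ →
      ∀ᵐ t ∂(volume.restrict (Ioo ((T, z).1 - r ^ 2) (T, z).1)),
        eLpNorm (u t) (q : ℝ≥0∞) (volume.restrict (ball (T, z).2 r)) *
          ENNReal.ofReal (r ^ (((q : ℝ) - 3) / q)) ≤ ENNReal.ofReal η := fun η hη =>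
    exists_ae_eLpNorm_le_of_tendsto_chaeLocalDeviation_zero hρ (hall0 1 one_pos) huv hη
  -- smallness at one scale: `q ≥ 3` by the pressure decay iteration, `q < 3` by `h₃`
  obtain ⟨r₀, hr₀, hr₀ρ, hsmall⟩ : ∃ r₀ : ℝ, 0 < r₀ ∧ r₀ ≤ ρ ∧
      cknC r₀ (T, z) u + cknD r₀ (T, z) P < ENNReal.ofReal ε := by
    rcases le_or_gt 3 q with hq3 | hq3
    · exact exists_cknC_add_cknD_lt_of_ae_eLpNorm_small hIB hq3 hS hε
    · exact h₃ hIB hq2 hq3 hS ε hε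
  refine ⟨r₀, hr₀, ?_, u, P, hIB.of_le_radius hr₀ hr₀ρ, ?_, hsmall⟩
  · nlinarith
  · exact ae_restrict_of_ae_restrict_of_subset (parabolicCylinder_mono hr₀.le hr₀ρ (T, z)) huv

end LocalLerayAssembly



end Literature.Analysis.FluidPDE

end
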